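import Summits.CriticalPhenomena.Ising3DConformalLimit.Theorems.ArmDressingArmDressingGlueInvVTransport
import Summits.CriticalPhenomena.Ising3DConformalLimit.Theorems.ArmDressingArmDressingGlueInvWScaling
import Summits.CriticalPhenomena.Ising3DConformalLimit.Theorems.ArmDressingArmDressingGlueDressedLimitExists
import HarnessLib

/-!
# Crux `ArmDressingGlue` (stmt-CriticalPhenomena-15700), stub 3' — part 5: dressed inversion covariance from
# non-degeneracy of the CROSS law (`stub_dressedInversionCovarianceOfPos`)

The registered LOAD-BEARING stub of the skeleton `Cruxes/ArmDressingGlue/Lines/birth.lean` (line `registered`,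
v2): `CrossLawPositive → DressedInversionCovariance`, i.e. given the non-degeneracy of the CROSS connection law,
cruxes A, B, C and the support ES, every normalised non-degenerate Euclidean-invariant scale-covariant (dimension
`Δ`) pointwise limit `S` of the critical correlators renormalised by `ρ₁ = 1/arm1(·,1)` is covariant under the unit
inversion with the same `Δ` — the transposition to `ℤ³` of Camia–Feng, arXiv:2411.01467, §3.2.3.

Assembly of parts 1–4 (`…InvSystems`, `…InvQTransport`, `…InvWScaling`, `…InvVSandwich`, `…InvVTransport`):
for even `n ≥ 2` and an injective configuration `x` off the origin, with a small radius `r`,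
`S n x = q(x)·v(x)` and `S n x* = q*(x*)·v*(x*)` (`S_eq_bPat_mul_cArm`: uniqueness of limits against
B(i)·C(i)·ES(c)); `q*(x*) = q(x)` (part 2) and `v*(x*) = ∏‖x_j‖^{2Δ} v(x)` (parts 3–4); odd `n`: both sides vanish
(the EVEN event is eventually empty, `DressedLimitProof.Pr_even_eq_zero_of_odd`); `n = 0`: trivial; non-injective
`x`: both sides vanish by the normalisation.

No definitions, no named facts, no sorry.
-/

noncomputable section

namespace Summit.CriticalPhenomena.Ising3DConformalLimit.Cruxes.ArmDressingGlue.InvBook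

open scoped BigOperators Topology
open Filter Set Metric EuclideanGeometry
open Literature.Probability.LatticeModels Literature.Probability.Percolation
open Literature.Barriers.CriticalPhenomena Literature.Geometry.Euclidean
open Summit.CriticalPhenomena.Ising3DConformalLimit.Theses
open Summit.CriticalPhenomena.Ising3DConformalLimit.Cruxes.ArmDressingGlue.Vocab
open Summit.CriticalPhenomena.Ising3DConformalLimit.Cruxes.ArmDressingGlue.DressedLimitProof

/-! ### Pointwise identification of the limit with `q · v` -/

/-- At a fixed injective configuration, the lattice approximations are eventually injective. [folklore] -/
theorem eventually_injective_latticeApprox_at {n : ℕ} {z : Fin n → EuclideanSpace ℝ (Fin 3)}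
    (hz : Function.Injective z) :
    ∀ᶠ δ in 𝓝[>] (0:ℝ), Function.Injective (fun i => latticeApprox δ (z i)) :=
  (eventually_injective_latticeApprox hz).curry.mono fun _ h => h.self_of_nhds

/-- **`S = q · v` pointwise** (Camia–Feng Thm 1 / §3.2.2 transposed, pointwise form): for an injective
configuration `z` inside the open balls of a system `(c, r)`, a `ρ₁`-limit `S`, the ES identity,
and witnesses `q` of B(i) and `v` of C(i): `S n z = q z · v z`. [cite: CamiaFeng2025, Thm 1 and §3.2.2] -/
theorem S_eq_bPat_mul_cArm {S : CorrFamily 3} (hlim : HasPointwiseScalingLimit (criticalCorr 3) rho1 S)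
    (hE : EdwardsSokalIdentity) {n : ℕ} {c : Fin n → EuclideanSpace ℝ (Fin 3)} {r : Fin n → ℝ}
    {q v : (Fin n → EuclideanSpace ℝ (Fin 3)) → ℝ} (hq : BPat n c r q) (hv : CArm n c r v)
    {z : Fin n → EuclideanSpace ℝ (Fin 3)} (hz : Function.Injective z) (hzU : ∀ j, z j ∈ ball (c j) (r j)) :
    S n z = q z * v z := by
  have hS : Tendsto (fun δ => rescaledCorrelator (criticalCorr 3) rho1 n δ z) (𝓝[>] 0) (𝓝 (S n z)) :=
    (hlim n).tendsto_at ((mem_nonCoincident z).2 hz)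
  have hQ := hq.2.2.tendsto_at hzU
  have hV := hv.2.2.tendsto_at hzU
  refine tendsto_nhds_unique hS ((hQ.mul hV).congr' ?_)
  have hX : ∀ᶠ δ in 𝓝[>] (0:ℝ), Pr (n + n) (Fin.append (pts n δ z)
      (fun j => disc δ (ball (c j) (r j))ᶜ)) (CROSS n) ≠ 0 := by
    filter_upwards [hV.eventually_const_lt (hv.2.1 z hzU)] with δ hδ h0
    rw [h0, zero_div] at hδ
    exact lt_irrefl _ hδ
  filter_upwards [hX, eventually_injective_latticeApprox_at hz] with δ hXδ hinj
  rw [rescaledCorrelator_apply, hE n _ hinj]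
  exact (inv_pow_mul_eq_div_mul_div n hXδ).symm

/-- Odd orders vanish at injective configurations (the EVEN event is eventually empty). [folklore] -/
theorem S_eq_zero_of_odd {S : CorrFamily 3} (hlim : HasPointwiseScalingLimit (criticalCorr 3) rho1 S)
    (hE : EdwardsSokalIdentity) {n : ℕ} (hn : Odd n) {z : Fin n → EuclideanSpace ℝ (Fin 3)}
    (hz : Function.Injective z) : S n z = 0 := by
  have hS : Tendsto (fun δ => rescaledCorrelator (criticalCorr 3) rho1 n δ z) (𝓝[>] 0) (𝓝 (S n z)) :=
    (hlim n).tendsto_at ((mem_nonCoincident z).2 hz)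
  refine tendsto_nhds_unique hS (tendsto_const_nhds.congr' ?_)
  filter_upwards [eventually_injective_latticeApprox_at hz] with δ hinj
  rw [rescaledCorrelator_apply, hE n _ hinj, Pr_even_eq_zero_of_odd hn, mul_zero]

/-! ### A radius adapted to a configuration off the origin -/

/-- For an injective configuration off the origin there is a radius `r > 0`, smaller than every `‖z_j‖`, with the
closed balls `B̄(z_j, r)` pairwise disjoint. [folklore] -/
theorem exists_good_radius {n : ℕ} {z : Fin n → EuclideanSpace ℝ (Fin 3)} (hz : Function.Injective z)
    (hz0 : ∀ j, z j ≠ 0) :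
    ∃ r : ℝ, 0 < r ∧ (∀ j, r < ‖z j‖) ∧
      ∀ j k, j ≠ k → Disjoint (closedBall (z j) r) (closedBall (z k) r) := by
  have h1 : ∀ᶠ r in 𝓝[>] (0:ℝ), ∀ j, r < ‖z j‖ :=
    eventually_all.2 fun j => by
      filter_upwards [Ioo_mem_nhdsGT (norm_pos_iff.2 (hz0 j))] with r hr using hr.2
  have h2 : ∀ᶠ r in 𝓝[>] (0:ℝ), ∀ j k, j ≠ k → Disjoint (closedBall (z j) r) (closedBall (z k) r) := by
    refine eventually_all.2 fun j => eventually_all.2 fun k => ?_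
    by_cases hjk : j = k
    · exact Eventually.of_forall fun _ h => (h hjk).elim
    · have hd : 0 < dist (z j) (z k) := dist_pos.2 (hz.ne hjk)
      filter_upwards [Ioo_mem_nhdsGT (half_pos hd)] with r hr _
      exact closedBall_disjoint_closedBall (by linarith [hr.2])
  have h0 : ∀ᶠ r in 𝓝[>] (0:ℝ), r ∈ Set.Ioi (0:ℝ) := eventually_mem_nhdsWithin
  obtain ⟨r, hr0, hr1, hr2⟩ := (h0.and (h1.and h2)).exists
  exact ⟨r, hr0, hr1, hr2⟩

/-! ### The main case: even `n ≥ 2`, injective configuration off the origin -/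

/-- **Inversion covariance at even orders `n ≥ 2`** for injective configurations off the origin.
[cite: CamiaFeng2025, §3.2.3] -/
theorem inversion_even (hPos : CrossLawPositive) (hA : ArmDressing.BallConnectivityMoebius)
    (hB : ArmDressing.EvenPatternDecoupling) (hC : ArmDressing.ArmExtensionFactorisation)
    (hE : EdwardsSokalIdentity) (hpos : Arm1Pos) {Δ : ℝ} {S : CorrFamily 3}
    (hlim : HasPointwiseScalingLimit (criticalCorr 3) rho1 S) (hnd : IsNondegenerateTwoPoint S)
    (hsc : IsScaleCovariant Δ S) {n : ℕ} (hn2 : 2 ≤ n) (heven : Even n)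
    {x : Fin n → EuclideanSpace ℝ (Fin 3)} (hx : Function.Injective x) (hx0 : ∀ i, x i ≠ 0) :
    S n (fun i => inversion 0 1 (x i)) = (∏ i, ‖x i‖ ^ (2 * Δ)) * S n x := by
  obtain ⟨r, hr, hrx, hdisj⟩ := exists_good_radius hx hx0
  have hn1 : 1 ≤ n := le_trans one_le_two hn2
  -- the un-inverted systems
  have hxU : ∀ j, x j ∈ ball (x j) ((fun _ => r) j) := fun j => mem_ball_self hr
  obtain ⟨q, hq, hqF⟩ := bPat_extract hB hn2 heven x (fun _ => r) (fun _ => hr) hdisj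
  obtain ⟨v, hv, hvF⟩ := cArm_extract hC hn1 x (fun _ => r) (fun _ => hr) hdisj
  obtain ⟨W, w, hW, hw, hT⟩ := hvF x hxU (fun _ => 1) (fun _ => one_pos)
  -- the inverted systems
  have hdisj' : ∀ j k, j ≠ k →
      Disjoint (closedBall ((‖x j‖ ^ 2 - r ^ 2)⁻¹ • x j) (r / (‖x j‖ ^ 2 - r ^ 2)))
        (closedBall ((‖x k‖ ^ 2 - r ^ 2)⁻¹ • x k) (r / (‖x k‖ ^ 2 - r ^ 2))) :=
    fun j k hjk => disjoint_closedBall_inversion hr.le (hrx j) hr.le (hrx k) (hdisj j k hjk)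
  have hr' : ∀ j, 0 < r / (‖x j‖ ^ 2 - r ^ 2) := fun j => ginv_radius_pos hr (hrx j)
  have hxU' : ∀ j, inversion 0 1 (x j) ∈ ball ((‖x j‖ ^ 2 - r ^ 2)⁻¹ • x j) (r / (‖x j‖ ^ 2 - r ^ 2)) :=
    fun j => inversion_mem_ball_image hr (hrx j)
  obtain ⟨qs, hqs, hqsF⟩ := bPat_extract hB hn2 heven _ _ hr' hdisj'
  obtain ⟨vs, hvs, hvsF⟩ := cArm_extract hC hn1 _ _ hr' hdisj'
  have hbpos : ∀ j, 0 < (‖x j‖ ^ 2)⁻¹ := fun j => inv_pos.2 (pow_pos (norm_pos_iff.2 (hx0 j)) 2)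
  obtain ⟨Ws, ws, hWs, hws, hTs⟩ := hvsF _ hxU' (fun j => (‖x j‖ ^ 2)⁻¹) hbpos
  -- the pointwise identifications `S = q v`
  have hxinj' : Function.Injective fun i => inversion 0 1 (x i) :=
    (inversion_injective (0 : EuclideanSpace ℝ (Fin 3)) one_ne_zero).comp hx
  have h1 : S n x = q x * v x := S_eq_bPat_mul_cArm hlim hE hq hv hx hxU
  have h2 : S n (fun i => inversion 0 1 (x i)) = qs (fun i => inversion 0 1 (x i)) * vs (fun i => inversion 0 1 (x i)) :=
    S_eq_bPat_mul_cArm hlim hE hqs hvs hxinj' hxU'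
  -- `q* = q`
  have hqq : qs (fun i => inversion 0 1 (x i)) = q x :=
    bFam_target_star_eq hPos hA hx0 hr hrx (hqF x hxU) (hqsF _ hxU')
  -- `v* = ∏ ‖x_j‖^{2Δ} v`
  have hwsc : ∀ κ : ℝ, 0 < κ → Tendsto (fun η => w (η * κ) / w η) (𝓝[>] 0) (𝓝 (κ ^ Δ)) :=
    fun κ hκ => tendsto_COne_ratio hC hpos hlim hnd hsc hw hκ
  have hvv : vs (fun i => inversion 0 1 (x i)) = (∏ j, ‖x j‖ ^ (2 * Δ)) * v x :=
    vStar_eq_weight_mul hx0 (fun ε hε hε1 => cFam_star_sandwich hPos hA hx0 hr hrx hW hWs hε hε1)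
      hT hTs (cOne_eventuallyEq hws hw) hwsc (cOne_eventually_pos hw (hwsc 2 two_pos))
  rw [h2, hqq, hvv, h1]
  ring

/-! ### The registered stub -/

/-- **STUB 3' — dressed inversion covariance from non-degeneracy** (registered load-bearing stub of the skeleton
of `ArmDressingGlue`; Camia–Feng 2025 §3.2.3 transposed to `ℤ³`): `CrossLawPositive → DressedInversionCovariance`.
[cite: CamiaFeng2025, §3.2.3] -/
theorem stub_dressedInversionCovarianceOfPos : CrossLawPositive → DressedInversionCovariance := by
  intro hPos hA hB hC hES Δ S hlim hnorm hnd _hE hsc n x hx0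
  have hE : EdwardsSokalIdentity := (infiniteVolumeEdwardsSokal_iff.1 hES).2.2
  have hpos : Arm1Pos := (infiniteVolumeEdwardsSokal_iff.1 hES).2.1
  by_cases hx : Function.Injective x
  · rcases Nat.even_or_odd n with heven | hodd
    · rcases Nat.lt_or_ge n 2 with hlt | hn2
      · -- `n = 0` (`n = 1` is odd)
        interval_cases n
        · have hfun : (fun i => inversion 0 1 (x i)) = x := funext fun i => i.elim0
          rw [hfun, Finset.univ_eq_empty, Finset.prod_empty, one_mul]
        · exact absurd heven (by decide)
      · exact inversion_even hPos hA hB hC hE hpos hlim hnd hsc hn2 heven hx hx0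
    · have hxinj' : Function.Injective fun i => inversion 0 1 (x i) :=
        (inversion_injective (0 : EuclideanSpace ℝ (Fin 3)) one_ne_zero).comp hx
      rw [S_eq_zero_of_odd hlim hE hodd hx, S_eq_zero_of_odd hlim hE hodd hxinj', mul_zero]
  · have hx' : ¬ Function.Injective fun i => inversion 0 1 (x i) := fun h =>
      hx fun i j hij => h (congrArg (inversion (0 : EuclideanSpace ℝ (Fin 3)) 1) hij)
    rw [hnorm n x (fun h => hx ((mem_nonCoincident x).1 h)),
      hnorm n _ (fun h => hx' ((mem_nonCoincident _).1 h)), mul_zero]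

end Summit.CriticalPhenomena.Ising3DConformalLimit.Cruxes.ArmDressingGlue.InvBook

end
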